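import Summits.AtomisticToContinuum.Crystallization.Theorems.FrustratedLawDichotomyStrainedPatchHomEntryFitHcpCentredRotPair

/-!
# The CENTRED fit verdict WITH THE ROTATION PAYLOAD: soundness of `fitOKHDCR`, the quick-verdict wrapper
# (27623 `(H) HomFloor (1/625)`, hcp half; hand-1 g31; sequel of `…CentredRotKit` / `…CentredRotPair`)

decomp-a2c hand-1 g31 (crux `AperiodicFrustratedLawGap`, stmt-AtomisticToContinuum-27623).  ★★★ `fitOKHDCR_sound` (Tight shape; `…RotKit.fitOKHDMR_sound` with
bullet (F1) = `…CentredRotPair.norm_pair_le_of_cPairOKR`), the union quick verdict `entryLeafOKHQDCR μ q := fitOKHDCR q ∨ fitOKHDM ∨ entryLeafOKHQ μ` + `_sound`.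
§2 (namespace `…HomEntryLeafHT`): the pruned slab leaf instance `entryLeafOKHT5QDCR(X)` + `_sound`, `hcpHalf_of_entryTreeHT5QDCRX`,
★★★ `homFloor_625_of_entryTrees6RBKP_HT5QDCRX`.

Def + soundness; 0 sorry; standard axioms; no instances / notation / `#eval`.  `--supports stmt-AtomisticToContinuum-27623`.
-/



noncomputable section

namespace Summit.AtomisticToContinuum.Crystallization.Theorems.FrustratedLawDichotomyStrainedPatchHomEntryFitHcpCentred

open scoped BigOperators RealInnerProductSpace Matrix
open Summit.AtomisticToContinuum.Crystallization.Theorems.FrustratedLawDichotomyStrainedPatchHomOrthogonal (exists_linearIsometry_of_orthogonal)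
open Literature.Analysis.ValidatedNumerics.Numerics
open Literature.Geometry.DiscreteGeometry (hcpKissingPattern)
open Literature.Geometry.DiscreteGeometry.ShellCensus (hcpTuple hcpTuple_injective)
open Summit.AtomisticToContinuum.Crystallization.Theorems.ChargedEnergyGapNegative (E3)
open Summit.AtomisticToContinuum.Crystallization.Theorems.FrustratedLawDichotomySchurCut (effPot w₄₅ ω₄)
open Summit.AtomisticToContinuum.Crystallization.Theorems.FrustratedLawDichotomyMotifLemmas (GoodAtScale)
open Summit.AtomisticToContinuum.Crystallization.Theorems.FrustratedLawDichotomyAveragingRuleTightFree (TightNearCap BadNearCap)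
open Summit.AtomisticToContinuum.Crystallization.Theorems.FrustratedLawDichotomyExemptAbsorption (ExemptNear)
open Summit.AtomisticToContinuum.Crystallization.Theorems.FrustratedLawDichotomyStrainedPatchHomSplit
open Summit.AtomisticToContinuum.Crystallization.Theorems.FrustratedLawDichotomyStrainedPatchHomGram (norm_sq_latPt_eq_sum_gram norm_sq_latPt_add_eq_sum_gram)
open Summit.AtomisticToContinuum.Crystallization.Theorems.FrustratedLawDichotomyStrainedPatchHomLatticeBox (norm_apply_ge_of_near_one latPt_zero)
open Summit.AtomisticToContinuum.Crystallization.Theorems.FrustratedLawDichotomyStrainedPatchHomLatticeBoxHcp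
  (latPt_eq_apply_one shifted_eq_apply mem_box_of_norm_hexPt_lt mem_box_of_norm_hexPt_add_shift_lt)
open Summit.AtomisticToContinuum.Crystallization.Theorems.FrustratedLawDichotomyStrainedPatchHomPrunesFit (goodAtScale_centre_of_fit_hcpPattern)
open Summit.AtomisticToContinuum.Crystallization.Theorems.FrustratedLawDichotomyAveragingCut (self_mem_ball)
open Summit.AtomisticToContinuum.Crystallization.Theorems.FrustratedLawDichotomyStrainedPatchHomPrunes (locHom_hcp_centre)
open Summit.AtomisticToContinuum.Crystallization.Theorems.FrustratedLawDichotomyStrainedPatchHomPrunedPolar (homFloor_of_prunedBoxSums_selfAdjoint)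
open Summit.AtomisticToContinuum.Crystallization.Theorems.FrustratedLawDichotomyStrainedPatchHomLeafCheckC (iccC iccC_eq)
open Summit.AtomisticToContinuum.Crystallization.Theorems.FrustratedLawDichotomyStrainedPatchHomCertTree (CertTree treeOK)
open Summit.AtomisticToContinuum.Crystallization.Theorems.FrustratedLawDichotomyStrainedPatchHomEntryGram
open Summit.AtomisticToContinuum.Crystallization.Theorems.FrustratedLawDichotomyStrainedPatchHomEntryFitKit (lmin lmin_le_of_mem lmin_mem)
open Summit.AtomisticToContinuum.Crystallization.Theorems.FrustratedLawDichotomyStrainedPatchHomEntryFit (scaleL devFI entryLeafOKF fccHalf_of_entryFitTree lmax le_lmax_of_mem)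
open Summit.AtomisticToContinuum.Crystallization.Theorems.FrustratedLawDichotomyStrainedPatchHomEntryGramHcp
open Summit.AtomisticToContinuum.Crystallization.Theorems.FrustratedLawDichotomyStrainedPatchHomEntryHcpFrame
open Summit.AtomisticToContinuum.Crystallization.Theorems.FrustratedLawDichotomyTwoShellRigidityAssemblyDial (hcpTuple_mem exists_hcpTuple_eq)
open Summit.AtomisticToContinuum.Crystallization.Theorems.FrustratedLawDichotomyStrainedPatchHomLatticeBoxHcp (latPt_eq_apply_one)
open Summit.AtomisticToContinuum.Crystallization.Theorems.FrustratedLawDichotomyStrainedPatchHomEntryFit (scaleL devFI lmax le_lmax_of_mem)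
open Summit.AtomisticToContinuum.Crystallization.Theorems.FrustratedLawDichotomyStrainedPatchHomEntryFitHcpKit
open Summit.AtomisticToContinuum.Crystallization.Theorems.FrustratedLawDichotomyStrainedPatchHomEntryFitHcp
open Summit.AtomisticToContinuum.Crystallization.Theorems.FrustratedLawDichotomyStrainedPatchHomEntrySearch
open Summit.AtomisticToContinuum.Crystallization.Theorems.FrustratedLawDichotomyStrainedPatchHomEntrySign (entryLeafOKD fccHalf_of_entrySearchDom)
open Summit.AtomisticToContinuum.Crystallization.Theorems.FrustratedLawDichotomyStrainedPatchHomEntryFitHcpSharpKit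
open Summit.AtomisticToContinuum.Crystallization.Theorems.FrustratedLawDichotomyStrainedPatchHomEntryFitHcpSharp

open Summit.AtomisticToContinuum.Crystallization.Theorems.FrustratedLawDichotomyStrainedPatchHomEntryFitHcpSharpEta
open Summit.AtomisticToContinuum.Crystallization.Theorems.FrustratedLawDichotomyStrainedPatchHomPrunedPolar (homFloor_of_prunedBoxSums_selfAdjoint)
open Summit.AtomisticToContinuum.Crystallization.Theorems.FrustratedLawDichotomyStrainedPatchHomEntryGram (rootC rootW)
open Summit.AtomisticToContinuum.Crystallization.Theorems.FrustratedLawDichotomyStrainedPatchHomEntryGramHcp (rootCH rootWH)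
open Summit.AtomisticToContinuum.Crystallization.Theorems.FrustratedLawDichotomyStrainedPatchHomEntryTable (muRec muRec_ok)
open Summit.AtomisticToContinuum.Crystallization.Theorems.FrustratedLawDichotomyStrainedPatchHomEntryTableP (entryLeafOK6RBKP)
open Summit.AtomisticToContinuum.Crystallization.Theorems.FrustratedLawDichotomyStrainedPatchHomEntryTreeCert (fccHalf_of_entryTree6RBKP)
open Summit.AtomisticToContinuum.Crystallization.Theorems.FrustratedLawDichotomyStrainedPatchHomEntryFlipHcp (HcpDich hcpHalf_of_entryTreeShuf)
open Summit.AtomisticToContinuum.Crystallization.Theorems.FrustratedLawDichotomyStrainedPatchHomEntrySymBox (symH hbox_symU)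
open Summit.AtomisticToContinuum.Crystallization.Theorems.FrustratedLawDichotomyStrainedPatchHomEntryQuickHcp (entryLeafOKHQ entryLeafOKHQ_imp)
open Summit.AtomisticToContinuum.Crystallization.Theorems.FrustratedLawDichotomyStrainedPatchHomLeafTableCheckHcpV (entryLeafOKHVK_sound)
open Summit.AtomisticToContinuum.Crystallization.Theorems.FrustratedLawDichotomyStrainedPatchHomCurvLeafHCC (entryLeafOKHCCX entryLeafOKHCCX_sound)
open Summit.AtomisticToContinuum.Crystallization.Theorems.FrustratedLawDichotomyStrainedPatchHomEntryLeafHT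
  (HTCert entryLeafOKHT4 entryLeafOKHT4_sound)
open Summit.AtomisticToContinuum.Crystallization.Theorems.FrustratedLawDichotomyStrainedPatchHomEntryFitTolerance (cT090 cT095 wU12X12 wU11X11)

/-! ## Soundness and the quick verdict -/

/-- ★★★ **SOUNDNESS OF `fitOKHDCR`** (Tight shape): `…RotKit.fitOKHDMR_sound` verbatim except bullet (F1), which is the centred rotated pair bound
`…CentredRotPair.norm_pair_le_of_cPairOKR`. [folklore chaining] -/
theorem fitOKHDCR_sound {c w : (Fin 3 × Fin 3) ⊕ Fin 3 → ℤ} {q : Fin 4 → ℤ} (h : fitOKHDCR c w q = true) (U : E3 →L[ℝ] E3) (ξ : E3)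
    (hsa : ∀ v v' : E3, ⟪U v, v'⟫ = ⟪v, U v'⟫) (hU : ‖U - 1‖ ≤ 1 / 4)
    (hbox : ∀ ab : Fin 3 × Fin 3, |(U (EuclideanSpace.single ab.2 (1 : ℝ))) ab.1 - (c (Sum.inl ab) : ℝ) / SC| ≤ (w (Sum.inl ab) : ℝ) / SC)
    (hξb : ∀ i : Fin 3, |ξ i - (c (Sum.inr i) : ℝ) / SC| ≤ (w (Sum.inr i) : ℝ) / SC) :
    ∀ (M : ℕ) (z : Fin M → E3) (c : Fin M), Function.Injective z →
      Set.range z = {x : E3 | dist x (z c) ≤ 133 / 10 ∧ ∃ a : Fin 3 → ℤ,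
        x = z c + latPt U hexFrame a ∨ x = z c + latPt U hexFrame a + U (hcpShift + ξ)} →
      TightNearCap (9 / 5) (3 / 2) z c ∨ ExemptNear (9 / 5) ExRec z c ∨ BadNearCap (9 / 5) (3 / 2) z c := by
  simp only [fitOKHDCR, Bool.and_eq_true, decide_eq_true_eq, List.all_eq_true] at h
  obtain ⟨⟨⟨⟨⟨⟨⟨⟨⟨⟨hsymm, hL0⟩, h0⟩, h01⟩, h32⟩, h130⟩, hxi4⟩, hNq⟩, hpair⟩, hK⟩, hfar⟩ := h
  obtain ⟨Riso, hRiso⟩ := exists_linearIsometry_of_orthogonal (cayQ q) (cayQ_orthogonal q hNq)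
  have hS := SC_pos
  have hne := SC_ne
  set cU : Fin 3 × Fin 3 → ℤ := fun ab => c (Sum.inl ab) with hcU
  set lam : ℝ := (scaleL cU : ℝ) / SC with hlam
  have hlam0 : 0 ≤ lam := div_nonneg (by exact_mod_cast hL0) hS.le
  set V : E3 →L[ℝ] E3 := U - lam • (1 : E3 →L[ℝ] E3) with hVdef
  have hV : ∀ x : E3, U x = lam • x + V x := fun x => by
    have : V x = U x - lam • x := by simp [hVdef]
    rw [this]; abel
  -- enclosures of the extended Gram data of `U`, of the deviation entries and of the shuffle
  have hE : ∀ ab : Fin 3 × Fin 3, FI.mem ((U (EuclideanSpace.single ab.2 (1 : ℝ))) ab.1) (entU c w ab) := fun ab => mem_entryFI (hbox ab)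
  have hE' : ∀ ab : Fin 3 × Fin 3, FI.mem ((V (EuclideanSpace.single ab.2 (1 : ℝ))) ab.1) (devH c w (scaleL cU) ab) :=
    FrustratedLawDichotomyStrainedPatchHomEntryFit.mem_devFI U (scaleL cU) hbox
  have hX : ∀ i, FI.mem (ξ i) (shufFI c w i) := fun i => mem_shufFI (hξb i)
  have hLm : FI.mem lam (FI.ofScaled (scaleL cU)) := FI.mem_ofScaled _
  obtain ⟨hUG, hUC, hUT⟩ : (∀ i j, FI.mem ⟪U (hexFrame i), U (hexFrame j)⟫ (extU c w (Sum.inl (i, j)))) ∧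
      (∀ i, FI.mem ⟪U (hexFrame i), U (hcpShift + ξ)⟫ (extU c w (Sum.inr (Sum.inl i)))) ∧
      FI.mem (‖U (hcpShift + ξ)‖ ^ 2) (extU c w (Sum.inr (Sum.inr 0))) := mem_extFI U ξ hE hX
  -- per label: ‖nbrU k‖² (Gram form, for `d`) and the sharp data
  have hnbr : ∀ k, FI.mem (‖nbrU U ξ k‖ ^ 2) (nbrSq c w k) := fun k => by
    have := mem_qform13 U (hcpShift + ξ) hUG hUC hUT (hlab k) (hshift k)
    unfold nbrU nbrSq; exact this
  set R : Fin 12 → E3 := fun k => rReal V ξ lam k with hRdef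
  have hdk : ∀ k, nbrU U ξ k = lam • nbr k + R k := fun k => nbrU_eq_smul_add_rReal hV ξ k
  have hRm : ∀ k a, FI.mem ((R k) a) (rVec (devH c w (scaleL cU)) (shufFI c w) (FI.ofScaled (scaleL cU)) k a) := fun k a =>
    mem_rVec V ξ hE' hX hLm k a
  have hP : ∀ k, FI.mem ⟪R k, nbr k⟫ (rP (devH c w (scaleL cU)) (shufFI c w) (FI.ofScaled (scaleL cU)) k) := fun k =>
    mem_dot3 (hRm k) (mem_nbrFI k)
  have hQ : ∀ k, FI.mem (‖R k‖ ^ 2) (rSq (devH c w (scaleL cU)) (shufFI c w) (FI.ofScaled (scaleL cU)) k) := fun k => by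
    rw [← real_inner_self_eq_norm_sq]; exact mem_dot3 (hRm k) (hRm k)
  have hN : ∀ k, FI.mem (‖nbrU U ξ k‖ ^ 2) (nrm2 (devH c w (scaleL cU)) (shufFI c w) (FI.ofScaled (scaleL cU)) k) := fun k => by
    have e : ‖nbrU U ξ k‖ ^ 2 = (lam ^ 2 + lam * ⟪R k, nbr k⟫ * ((2 : ℤ) : ℝ)) + ‖R k‖ ^ 2 := by
      rw [hdk, norm_add_sq_real, norm_smul, Real.norm_eq_abs, abs_of_nonneg hlam0, norm_nbr, mul_one, real_inner_smul_left,
        real_inner_comm]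
      push_cast; ring
    rw [e]
    exact FI.mem_add (FI.mem_add (FI.mem_sqr hLm) (FI.mem_mulInt (FI.mem_mul hLm (hP k)) 2)) (hQ k)
  have hD : ∀ k, FI.mem (‖nbrU U ξ k‖ - lam) (dlt (devH c w (scaleL cU)) (shufFI c w) (FI.ofScaled (scaleL cU)) k) := fun k => by
    have := FI.mem_sqrt (hN k)
    rw [Real.sqrt_sq (norm_nonneg _)] at this
    exact FI.mem_sub this hLm
  have hMis : ∀ k k', FI.mem (‖nbrU U ξ k - ‖nbrU U ξ k'‖ • nbr k‖ ^ 2)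
      (mis (devH c w (scaleL cU)) (shufFI c w) (FI.ofScaled (scaleL cU)) k k') := fun k k' => by
    have hsplit : nbrU U ξ k - ‖nbrU U ξ k'‖ • nbr k = R k - (‖nbrU U ξ k'‖ - lam) • nbr k := by
      rw [hdk, sub_smul]; abel
    have e : ‖nbrU U ξ k - ‖nbrU U ξ k'‖ • nbr k‖ ^ 2 =
        (‖R k‖ ^ 2 - (‖nbrU U ξ k'‖ - lam) * ⟪R k, nbr k⟫ * ((2 : ℤ) : ℝ)) + (‖nbrU U ξ k'‖ - lam) ^ 2 := by
      rw [hsplit, norm_sub_sq_real, norm_smul, Real.norm_eq_abs, norm_nbr, mul_one, sq_abs, real_inner_smul_right]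
      push_cast; ring
    rw [e]
    exact FI.mem_add (FI.mem_sub (hQ k) (FI.mem_mulInt (FI.mem_mul (hD k') (hP k)) 2)) (FI.mem_sqr (hD k'))
  -- `‖ξ‖ ≤ 1/2`
  have hxi : FI.mem (‖ξ‖ ^ 2) (xiSq c w) := by
    rw [EuclideanSpace.norm_sq_eq, Fin.sum_univ_three]
    simp only [Real.norm_eq_abs, sq_abs]
    exact FI.mem_add (FI.mem_add (FI.mem_sqr (hX 0)) (FI.mem_sqr (hX 1))) (FI.mem_sqr (hX 2))
  have hξ2 : ‖ξ‖ ≤ 1 / 2 := by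
    have h1 := (FI.mem_def.1 hxi).2
    have h2 : (4 : ℝ) * (xiSq c w).hi ≤ SC := by exact_mod_cast hxi4
    have h3 : ‖ξ‖ ^ 2 * SC * 4 ≤ SC * 1 := by linarith
    have hsq : ‖ξ‖ ^ 2 ≤ (1 / 2) ^ 2 := by
      have := le_of_mul_le_mul_right (by linarith : ‖ξ‖ ^ 2 * 4 * SC ≤ 1 * SC) hS
      linarith
    exact (abs_le_of_sq_le_sq' hsq (by norm_num)).2
  -- the minimum and its enclosures
  obtain ⟨k₀, -, hk₀⟩ := Finset.exists_min_image Finset.univ (fun k : Fin 12 => ‖nbrU U ξ k‖) Finset.univ_nonempty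
  have hd_le : ∀ k, ‖nbrU U ξ k₀‖ ≤ ‖nbrU U ξ k‖ := fun k => hk₀ k (Finset.mem_univ k)
  have hd0 : 0 ≤ ‖nbrU U ξ k₀‖ := norm_nonneg _
  have hDsq_lo : ∀ k, ((dSqH c w).lo : ℝ) ≤ ‖nbrU U ξ k‖ ^ 2 * SC := fun k => by
    have h1 : lmin (K12H.map fun k => (nbrSq c w k).lo) ≤ (nbrSq c w k).lo := lmin_le_of_mem _ _ (List.mem_map.2 ⟨k, mem_K12H k, rfl⟩)
    have h1' : ((lmin (K12H.map fun k => (nbrSq c w k).lo) : ℤ) : ℝ) ≤ (nbrSq c w k).lo := by exact_mod_cast h1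
    exact h1'.trans (FI.mem_def.1 (hnbr k)).1
  have hmemDsq : FI.mem (‖nbrU U ξ k₀‖ ^ 2) (dSqH c w) := by
    refine ⟨hDsq_lo k₀, ?_⟩
    have hl : (K12H.map fun k => (nbrSq c w k).hi) ≠ [] := by simp [K12H]
    obtain ⟨k', _, he⟩ := List.mem_map.1 (lmin_mem _ hl)
    have h2 := (FI.mem_def.1 (hnbr k')).2
    have hle := mul_le_mul_of_nonneg_right (pow_le_pow_left₀ hd0 (hd_le k') 2) hS.le
    show ‖nbrU U ξ k₀‖ ^ 2 * SC ≤ (((dSqH c w).hi : ℤ) : ℝ)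
    rw [show (dSqH c w).hi = lmin (K12H.map fun k => (nbrSq c w k).hi) from rfl, ← he]
    linarith
  have hmemD : FI.mem ‖nbrU U ξ k₀‖ (dEnclH c w) := by
    have := FI.mem_sqrt hmemDsq
    rwa [Real.sqrt_sq hd0] at this
  obtain ⟨hDlo, hDhi⟩ := FI.mem_def.1 hmemD
  have h0' : (0 : ℝ) < (dEnclH c w).lo := by exact_mod_cast h0
  -- the sharp `d²` lower end
  have hd2S : ∀ k, ((d2S c w (scaleL cU) : ℤ) : ℝ) ≤ ‖nbrU U ξ k‖ ^ 2 * SC := fun k => by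
    have h1 : d2S c w (scaleL cU) ≤ (nrm2 (devH c w (scaleL cU)) (shufFI c w) (FI.ofScaled (scaleL cU)) k).lo :=
      lmin_le_of_mem _ _ (List.mem_map.2 ⟨k, mem_K12H k, rfl⟩)
    have h1' : ((d2S c w (scaleL cU) : ℤ) : ℝ) ≤ (nrm2 (devH c w (scaleL cU)) (shufFI c w) (FI.ofScaled (scaleL cU)) k).lo := by
      exact_mod_cast h1
    exact h1'.trans (FI.mem_def.1 (hN k)).1
  refine fun M z j hz hrange => Or.inl ⟨j, self_mem_ball (by norm_num) z j,
    goodAtScale_of_fitBounds_hcp_eta_minR Riso U ξ hU hξ2 (η' := 4999 / 100000) (by norm_num) (by norm_num) (dlo := ((dEnclH c w).lo : ℝ) / SC) (dhi := ((dEnclH c w).hi : ℝ) / SC)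
      (d2lo := ((d2S c w (scaleL cU) : ℤ) : ℝ) / SC) (div_pos h0' hS) ?_ ?_ ?_ ?_ ?_ ?_ ?_ ?_ M z j hz (locHom_hcp_centre hrange)⟩
  · -- dhi ≤ 3/2
    rw [div_le_iff₀ hS]
    have : (2 : ℝ) * (dEnclH c w).hi ≤ 3 * SC := by exact_mod_cast h32
    linarith
  · -- (d) lower
    intro k
    have := mul_le_mul_of_nonneg_right (hd_le k) hS.le
    rw [div_le_iff₀ hS]
    linarith
  · -- (d) upper
    exact ⟨k₀, by rw [le_div_iff₀ hS]; exact hDhi⟩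
  · -- d2lo
    intro k
    rw [div_le_iff₀ hS]
    exact hd2S k
  · -- (F1) the CENTRED ROTATED pair bound, for minimising scales `k'` only
    intro k k' hk'
    have hposs : possMinH c w k' = true := by
      unfold possMinH
      rw [decide_eq_true_eq]
      have hl : (K12H.map fun k => (nbrSq c w k).hi) ≠ [] := by simp [K12H]
      obtain ⟨j', _, he⟩ := List.mem_map.1 (lmin_mem _ hl)
      have h1 := (FI.mem_def.1 (hnbr k')).1
      have h2 := (FI.mem_def.1 (hnbr j')).2
      have hle := mul_le_mul_of_nonneg_right (pow_le_pow_left₀ (norm_nonneg _) (hk' j') 2) hS.le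
      have key : (((nbrSq c w k').lo : ℤ) : ℝ) ≤ ((lmin (K12H.map fun k => (nbrSq c w k).hi) : ℤ) : ℝ) := by
        rw [← he]
        linarith
      have key' : (nbrSq c w k').lo ≤ lmin (K12H.map fun k => (nbrSq c w k).hi) := by exact_mod_cast key
      exact key'
    have hp := hpair k (mem_K12H k) k' (mem_K12H k')
    rw [hposs] at hp
    exact norm_pair_le_of_cPairOKR hsymm U ξ hsa hbox hξb k k' q Riso hRiso hNq (by simpa using hp)
  · -- (F2) clean gap
    intro k
    have f3 := hK k (mem_K12H k)
    have hC := (FI.mem_def.1 (hnbr k)).2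
    have f3' : ((nbrSq c w k).hi : ℝ) * SC * 10000 ≤ (130 * (dEnclH c w).lo - SC) ^ 2 := by exact_mod_cast f3
    have h130' : (SC : ℝ) ≤ 130 * (dEnclH c w).lo := by exact_mod_cast h130
    have hC' := mul_le_mul_of_nonneg_right hC (by positivity : (0 : ℝ) ≤ SC * 10000)
    have hsq : (‖nbrU U ξ k‖ * (100 * SC)) ^ 2 ≤ ((130 : ℝ) * (dEnclH c w).lo - SC) ^ 2 := by
      have e : (‖nbrU U ξ k‖ * (100 * SC)) ^ 2 = ‖nbrU U ξ k‖ ^ 2 * SC * (SC * 10000) := by ring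
      rw [e]; linarith
    have hle := (abs_le_of_sq_le_sq' hsq (by linarith)).2
    rw [show (13 : ℝ) / 10 * (((dEnclH c w).lo : ℝ) / SC) - 1 / 100 = (130 * ((dEnclH c w).lo : ℝ) - SC) / (100 * SC) by field_simp; ring,
      le_div_iff₀ (by positivity)]
    exact hle
  · -- (F3) far, family A
    intro b hb hb0 hnot
    rw [← box7all_eq] at hb
    obtain ⟨hA, _⟩ := hfar b hb
    rcases hA with rfl | ⟨k, hk, he⟩ | f4
    · exact (hb0 rfl).elim
    · exact (hnot k hk he).elim
    · have f4' : ((130 : ℝ) * (dEnclH c w).hi + SC) ^ 2 ≤ ((qform13 (extU c w) b false).lo : ℝ) * SC * 10000 := by exact_mod_cast f4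
      have hm := mem_qform13 U (hcpShift + ξ) hUG hUC hUT b false
      simp only [Bool.false_eq_true, ↓reduceIte, add_zero] at hm
      have hC := (FI.mem_def.1 hm).1
      have hC' := mul_le_mul_of_nonneg_right hC (by positivity : (0 : ℝ) ≤ SC * 10000)
      have hsq : ((130 : ℝ) * (dEnclH c w).hi + SC) ^ 2 ≤ (‖latPt U hexFrame b‖ * (100 * SC)) ^ 2 := by
        have e : (‖latPt U hexFrame b‖ * (100 * SC)) ^ 2 = ‖latPt U hexFrame b‖ ^ 2 * SC * (SC * 10000) := by ring
        rw [e]; linarith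
      have hle := (abs_le_of_sq_le_sq' hsq (by positivity)).2
      rw [show (13 : ℝ) / 10 * (((dEnclH c w).hi : ℝ) / SC) + 1 / 100 = (130 * ((dEnclH c w).hi : ℝ) + SC) / (100 * SC) by field_simp; ring,
        div_le_iff₀ (by positivity)]
      exact hle
  · -- (F3) far, family B
    intro b hb hnot
    rw [← box7all_eq] at hb
    obtain ⟨_, hB⟩ := hfar b hb
    rcases hB with ⟨k, hk, he⟩ | f4
    · exact (hnot k hk he).elim
    · have f4' : ((130 : ℝ) * (dEnclH c w).hi + SC) ^ 2 ≤ ((qform13 (extU c w) b true).lo : ℝ) * SC * 10000 := by exact_mod_cast f4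
      have hm := mem_qform13 U (hcpShift + ξ) hUG hUC hUT b true
      simp only [↓reduceIte] at hm
      have hC := (FI.mem_def.1 hm).1
      have hC' := mul_le_mul_of_nonneg_right hC (by positivity : (0 : ℝ) ≤ SC * 10000)
      have hsq : ((130 : ℝ) * (dEnclH c w).hi + SC) ^ 2 ≤ (‖latPt U hexFrame b + U (hcpShift + ξ)‖ * (100 * SC)) ^ 2 := by
        have e : (‖latPt U hexFrame b + U (hcpShift + ξ)‖ * (100 * SC)) ^ 2 = ‖latPt U hexFrame b + U (hcpShift + ξ)‖ ^ 2 * SC * (SC * 10000) := by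
          ring
        rw [e]; linarith
      have hle := (abs_le_of_sq_le_sq' hsq (by positivity)).2
      rw [show (13 : ℝ) / 10 * (((dEnclH c w).hi : ℝ) / SC) + 1 / 100 = (130 * ((dEnclH c w).hi : ℝ) + SC) / (100 * SC) by field_simp; ring,
        div_le_iff₀ (by positivity)]
      exact hle

/-- ★ **hcp QUICK VERDICT WITH THE ROTATION PAYLOAD**: CENTRED ROTATED fit `fitOKHDCR … q`, else the min-pairs centred fit `fitOKHDM`, else the quick verdict of record
`entryLeafOKHQ μ`. -/
def entryLeafOKHQDCR (μ : ℤ) (q : Fin 4 → ℤ) (c w : (Fin 3 × Fin 3) ⊕ Fin 3 → ℤ) : Bool :=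
  fitOKHDCR (symH c) (symH w) q || fitOKHDM (symH c) (symH w) || entryLeafOKHQ μ c w

/-- ★ **Soundness of `entryLeafOKHQDCR` in the hver shape** (exactly the `hinner` hypothesis of `…HomEntryLeafHT4.entryLeafOKHT4_sound`). [folklore chaining:
`fitOKHDM_sound` on the symmetrised box (`hbox_symU`), else `entryLeafOKHQ_imp` + `entryLeafOKHVK_sound`] -/
theorem entryLeafOKHQDCR_sound {μ : ℤ} {q : Fin 4 → ℤ} (c w : (Fin 3 × Fin 3) ⊕ Fin 3 → ℤ) (h : entryLeafOKHQDCR μ q c w = true) (U : E3 →L[ℝ] E3) (ξ : E3)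
    (hsa : ∀ v v' : E3, ⟪U v, v'⟫ = ⟪v, U v'⟫) (hU : ‖U - 1‖ ≤ 1 / 4)
    (hbox : ∀ ab : Fin 3 × Fin 3, |(U (EuclideanSpace.single ab.2 (1 : ℝ))) ab.1 - (c (Sum.inl ab) : ℝ) / SC| ≤ (w (Sum.inl ab) : ℝ) / SC)
    (hξ : ∀ i : Fin 3, |ξ i - (c (Sum.inr i) : ℝ) / SC| ≤ (w (Sum.inr i) : ℝ) / SC) (h0 : 0 ≤ ξ 0) (h2 : 0 ≤ ξ 2) :
    (∀ (M : ℕ) (z : Fin M → E3) (cc : Fin M), Function.Injective z →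
        Set.range z = {x : E3 | dist x (z cc) ≤ 133 / 10 ∧ ∃ a : Fin 3 → ℤ,
          x = z cc + latPt U hexFrame a ∨ x = z cc + latPt U hexFrame a + U (hcpShift + ξ)} →
        TightNearCap (9 / 5) (3 / 2) z cc ∨ ExemptNear (9 / 5) ExRec z cc ∨ BadNearCap (9 / 5) (3 / 2) z cc) ∨
      (μ : ℝ) / SC ≤ ∑ b ∈ (Fintype.piFinset fun _ : Fin 3 => Finset.Icc (-7 : ℤ) 7).filter (fun b => b ≠ 0), effPot w₄₅ ω₄ (3 / 400) ‖latPt U hexFrame b‖ +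
        ∑ b ∈ (Fintype.piFinset fun _ : Fin 3 => Finset.Icc (-7 : ℤ) 7), effPot w₄₅ ω₄ (3 / 400) ‖latPt U hexFrame b + U (hcpShift + ξ)‖ := by
  simp only [entryLeafOKHQDCR, Bool.or_eq_true] at h
  rcases h with (h | h) | h
  · exact Or.inl (fitOKHDCR_sound h U ξ hsa hU (hbox_symU hsa hbox) hξ)
  · exact Or.inl (fitOKHDM_sound h U ξ hsa hU (hbox_symU hsa hbox) hξ)
  · exact entryLeafOKHVK_sound (entryLeafOKHQ_imp μ c w h) U ξ hsa hU hbox hξ h0 h2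



end Summit.AtomisticToContinuum.Crystallization.Theorems.FrustratedLawDichotomyStrainedPatchHomEntryFitHcpCentred

namespace Summit.AtomisticToContinuum.Crystallization.Theorems.FrustratedLawDichotomyStrainedPatchHomEntryLeafHT

open scoped BigOperators RealInnerProductSpace
open Literature.Analysis.ValidatedNumerics.Numerics
open Summit.AtomisticToContinuum.Crystallization.Theorems.ChargedEnergyGapNegative (E3)
open Summit.AtomisticToContinuum.Crystallization.Theorems.FrustratedLawDichotomySchurCut (effPot w₄₅ ω₄)
open Summit.AtomisticToContinuum.Crystallization.Theorems.FrustratedLawDichotomyAveragingRuleTightFree (TightNearCap BadNearCap)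
open Summit.AtomisticToContinuum.Crystallization.Theorems.FrustratedLawDichotomyExemptAbsorption (ExemptNear)
open Summit.AtomisticToContinuum.Crystallization.Theorems.FrustratedLawDichotomyStrainedPatchHomSplit (ExRec latPt hexFrame hcpShift HomFloor)
open Summit.AtomisticToContinuum.Crystallization.Theorems.FrustratedLawDichotomyStrainedPatchTaylorChord (segGd)
open Summit.AtomisticToContinuum.Crystallization.Theorems.FrustratedLawDichotomyStrainedPatchHomCoords (apply_eq_sum_entries)
open Summit.AtomisticToContinuum.Crystallization.Theorems.FrustratedLawDichotomyStrainedPatchHomEntryGram (entryFI mem_entryFI)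
open Summit.AtomisticToContinuum.Crystallization.Theorems.FrustratedLawDichotomyStrainedPatchHomEntryGramHcp (dot3 shufFI mem_dot3 mem_shufFI)
open Summit.AtomisticToContinuum.Crystallization.Theorems.FrustratedLawDichotomyStrainedPatchHomCurvCentreKit (cenShuf cenShuf_apply)
open Summit.AtomisticToContinuum.Crystallization.Theorems.FrustratedLawDichotomyStrainedPatchHomCurvLJ (curvCheckLJM)
open Summit.AtomisticToContinuum.Crystallization.Theorems.FrustratedLawDichotomyStrainedPatchHomForceJacN
  (fjQ fjE forceJacCheckN boxLabels11 boxLabels11_toFinset)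
open Summit.AtomisticToContinuum.Crystallization.Theorems.FrustratedLawDichotomyStrainedPatchHomForceHcp (xiBallOK norm_le_quarter_of_xiBallOK)
open Summit.AtomisticToContinuum.Crystallization.Theorems.FrustratedLawDichotomyStrainedPatchHomCurvLeafHCC (entryLeafOKHCCX entryLeafOKHCCX_sound)
open Summit.AtomisticToContinuum.Crystallization.Theorems.FrustratedLawDichotomyStrainedPatchHomSlabConfine (abs_apply_le_of_qcert)
open Summit.AtomisticToContinuum.Crystallization.Theorems.FrustratedLawDichotomyStrainedPatchHomSlabLeaf
  (jac_floorM_of_three_checks abs_coord_le_of_confined hver_of_slabParts)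
open Summit.AtomisticToContinuum.Crystallization.Theorems.FrustratedLawDichotomyStrainedPatchHomPrunedPolar (homFloor_of_prunedBoxSums_selfAdjoint)
open Summit.AtomisticToContinuum.Crystallization.Theorems.FrustratedLawDichotomyStrainedPatchHomCertTree (CertTree treeOK treeOK_sound)
open Summit.AtomisticToContinuum.Crystallization.Theorems.FrustratedLawDichotomyStrainedPatchHomEntryGram (rootC rootW)
open Summit.AtomisticToContinuum.Crystallization.Theorems.FrustratedLawDichotomyStrainedPatchHomEntryGramHcp (rootCH rootWH)
open Summit.AtomisticToContinuum.Crystallization.Theorems.FrustratedLawDichotomyStrainedPatchHomEntryTable (muRec muRec_ok)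
open Summit.AtomisticToContinuum.Crystallization.Theorems.FrustratedLawDichotomyStrainedPatchHomEntryTableP (entryLeafOK6RBKP)
open Summit.AtomisticToContinuum.Crystallization.Theorems.FrustratedLawDichotomyStrainedPatchHomEntryTreeCert (fccHalf_of_entryTree6RBKP)
open Summit.AtomisticToContinuum.Crystallization.Theorems.FrustratedLawDichotomyStrainedPatchHomEntryFlipHcp (HcpDich hcpHalf_of_entryTreeShuf)
open Summit.AtomisticToContinuum.Crystallization.Theorems.FrustratedLawDichotomyStrainedPatchHomEntryFitHcpCentred (entryLeafOKHQDCR entryLeafOKHQDCR_sound)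

/-- ★ The pruned slab leaf with inner sub-tree verdict `entryLeafOKHQDCR μ q` (min-pairs centred ∨ rotated ∨ quick). -/
def entryLeafOKHT5QDCR (μ : ℤ) (q : Fin 4 → ℤ) (p : HTCert) (t : CertTree ((Fin 3 × Fin 3) ⊕ Fin 3)) (c w : (Fin 3 × Fin 3) ⊕ Fin 3 → ℤ) : Bool :=
  entryLeafOKHT5 (entryLeafOKHQDCR μ q) p t c w

/-- ★★ Soundness of `entryLeafOKHT5QDCR` in the hver shape. [folklore chaining: `entryLeafOKHT5_sound` with `entryLeafOKHQD_sound`] -/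
theorem entryLeafOKHT5QDCR_sound {μ : ℤ} {q : Fin 4 → ℤ} {p : HTCert} {t : CertTree ((Fin 3 × Fin 3) ⊕ Fin 3)} {c w : (Fin 3 × Fin 3) ⊕ Fin 3 → ℤ}
    (h : entryLeafOKHT5QDCR μ q p t c w = true) (U : E3 →L[ℝ] E3) (ξ : E3)
    (hsa : ∀ v v' : E3, ⟪U v, v'⟫ = ⟪v, U v'⟫) (hU : ‖U - 1‖ ≤ 1 / 4)
    (hbox : ∀ ab : Fin 3 × Fin 3, |(U (EuclideanSpace.single ab.2 (1 : ℝ))) ab.1 - (c (Sum.inl ab) : ℝ) / SC| ≤ (w (Sum.inl ab) : ℝ) / SC)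
    (hξ : ∀ i : Fin 3, |ξ i - (c (Sum.inr i) : ℝ) / SC| ≤ (w (Sum.inr i) : ℝ) / SC) (h0 : 0 ≤ ξ 0) (h2 : 0 ≤ ξ 2) :
    (∀ (M : ℕ) (z : Fin M → E3) (cc : Fin M), Function.Injective z →
        Set.range z = {x : E3 | dist x (z cc) ≤ 133 / 10 ∧ ∃ a : Fin 3 → ℤ,
          x = z cc + latPt U hexFrame a ∨ x = z cc + latPt U hexFrame a + U (hcpShift + ξ)} →
        TightNearCap (9 / 5) (3 / 2) z cc ∨ ExemptNear (9 / 5) ExRec z cc ∨ BadNearCap (9 / 5) (3 / 2) z cc) ∨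
      (μ : ℝ) / SC ≤ ∑ b ∈ (Fintype.piFinset fun _ : Fin 3 => Finset.Icc (-7 : ℤ) 7).filter (fun b => b ≠ 0), effPot w₄₅ ω₄ (3 / 400) ‖latPt U hexFrame b‖ +
        ∑ b ∈ (Fintype.piFinset fun _ : Fin 3 => Finset.Icc (-7 : ℤ) 7), effPot w₄₅ ω₄ (3 / 400) ‖latPt U hexFrame b + U (hcpShift + ξ)‖ :=
  entryLeafOKHT5_sound (fun c' w' hv V η hVsa hV1 hVb hη h0' h2' => entryLeafOKHQDCR_sound c' w' hv V η hVsa hV1 hVb hη h0' h2') h U ξ hsa hU hbox hξ h0 h2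

/-- ★ The union verdict with payload FUNCTIONS (certificate `P c w`, inner sub-tree `T c w`), else the union verdict of record `entryLeafOKHCCX μ`. -/
def entryLeafOKHT5QDCRX (μ : ℤ) (P : ((Fin 3 × Fin 3) ⊕ Fin 3 → ℤ) → ((Fin 3 × Fin 3) ⊕ Fin 3 → ℤ) → HTCert)
    (Qf : ((Fin 3 × Fin 3) ⊕ Fin 3 → ℤ) → ((Fin 3 × Fin 3) ⊕ Fin 3 → ℤ) → (Fin 4 → ℤ))
    (T : ((Fin 3 × Fin 3) ⊕ Fin 3 → ℤ) → ((Fin 3 × Fin 3) ⊕ Fin 3 → ℤ) → CertTree ((Fin 3 × Fin 3) ⊕ Fin 3))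
    (c w : (Fin 3 × Fin 3) ⊕ Fin 3 → ℤ) : Bool :=
  entryLeafOKHT5QDCR μ (Qf c w) (P c w) (T c w) c w || entryLeafOKHCCX μ c w

/-- ★★ Soundness of `entryLeafOKHT5QDCRX` in the hver shape. [folklore chaining] -/
theorem entryLeafOKHT5QDCRX_sound {μ : ℤ} {P : ((Fin 3 × Fin 3) ⊕ Fin 3 → ℤ) → ((Fin 3 × Fin 3) ⊕ Fin 3 → ℤ) → HTCert}
    {Qf : ((Fin 3 × Fin 3) ⊕ Fin 3 → ℤ) → ((Fin 3 × Fin 3) ⊕ Fin 3 → ℤ) → (Fin 4 → ℤ)}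
    {T : ((Fin 3 × Fin 3) ⊕ Fin 3 → ℤ) → ((Fin 3 × Fin 3) ⊕ Fin 3 → ℤ) → CertTree ((Fin 3 × Fin 3) ⊕ Fin 3)}
    {c w : (Fin 3 × Fin 3) ⊕ Fin 3 → ℤ} (h : entryLeafOKHT5QDCRX μ P Qf T c w = true) (U : E3 →L[ℝ] E3) (ξ : E3)
    (hsa : ∀ v v' : E3, ⟪U v, v'⟫ = ⟪v, U v'⟫) (hU : ‖U - 1‖ ≤ 1 / 4)
    (hbox : ∀ ab : Fin 3 × Fin 3, |(U (EuclideanSpace.single ab.2 (1 : ℝ))) ab.1 - (c (Sum.inl ab) : ℝ) / SC| ≤ (w (Sum.inl ab) : ℝ) / SC)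
    (hξ : ∀ i : Fin 3, |ξ i - (c (Sum.inr i) : ℝ) / SC| ≤ (w (Sum.inr i) : ℝ) / SC) (h0 : 0 ≤ ξ 0) (h2 : 0 ≤ ξ 2) :
    (∀ (M : ℕ) (z : Fin M → E3) (cc : Fin M), Function.Injective z →
        Set.range z = {x : E3 | dist x (z cc) ≤ 133 / 10 ∧ ∃ a : Fin 3 → ℤ,
          x = z cc + latPt U hexFrame a ∨ x = z cc + latPt U hexFrame a + U (hcpShift + ξ)} →
        TightNearCap (9 / 5) (3 / 2) z cc ∨ ExemptNear (9 / 5) ExRec z cc ∨ BadNearCap (9 / 5) (3 / 2) z cc) ∨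
      (μ : ℝ) / SC ≤ ∑ b ∈ (Fintype.piFinset fun _ : Fin 3 => Finset.Icc (-7 : ℤ) 7).filter (fun b => b ≠ 0), effPot w₄₅ ω₄ (3 / 400) ‖latPt U hexFrame b‖ +
        ∑ b ∈ (Fintype.piFinset fun _ : Fin 3 => Finset.Icc (-7 : ℤ) 7), effPot w₄₅ ω₄ (3 / 400) ‖latPt U hexFrame b + U (hcpShift + ξ)‖ := by
  simp only [entryLeafOKHT5QDCRX, Bool.or_eq_true] at h
  rcases h with h | h
  · exact entryLeafOKHT5QDCR_sound h U ξ hsa hU hbox hξ h0 h2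
  · exact entryLeafOKHCCX_sound h U ξ hsa hU hbox hξ h0 h2

/-- ★★ The hcp half from ONE certificate tree over `entryLeafOKHT5QDCRX μ P T`. [folklore chaining] -/
theorem hcpHalf_of_entryTreeHT5QDCRX {m : ℝ} {μ : ℤ} (hμ : 2 * (m + (-(7175 / 10000) + 3 / 400)) * SC ≤ μ)
    (P : ((Fin 3 × Fin 3) ⊕ Fin 3 → ℤ) → ((Fin 3 × Fin 3) ⊕ Fin 3 → ℤ) → HTCert)
    (Qf : ((Fin 3 × Fin 3) ⊕ Fin 3 → ℤ) → ((Fin 3 × Fin 3) ⊕ Fin 3 → ℤ) → (Fin 4 → ℤ))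
    (T : ((Fin 3 × Fin 3) ⊕ Fin 3 → ℤ) → ((Fin 3 × Fin 3) ⊕ Fin 3 → ℤ) → CertTree ((Fin 3 × Fin 3) ⊕ Fin 3))
    {t : CertTree ((Fin 3 × Fin 3) ⊕ Fin 3)} (h : treeOK (entryLeafOKHT5QDCRX μ P Qf T) t rootCH rootWH = true) :
    ∀ (U : E3 →L[ℝ] E3) (ξ : E3), (∀ v w : E3, inner ℝ (U v) w = inner ℝ v (U w)) → (∀ w : E3, 0 ≤ inner ℝ w (U w)) →
      ‖U - 1‖ ≤ 1 / 4 → ‖ξ‖ ≤ 1 / 4 → HcpDich m U ξ :=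
  hcpHalf_of_entryTreeShuf hμ (entryLeafOKHT5QDCRX μ P Qf T) (fun _ _ hv U ξ hsa hU hbox hξ h0 h2 => entryLeafOKHT5QDCRX_sound hv U ξ hsa hU hbox hξ h0 h2) h

/-- ★★★ **`(H) HomFloor (1/625)` OVER THE PRUNED SLAB-WITH-SUB-TREE VERDICT** (`μ = muRec`; any payload functions `P`, `T`). [folklore] -/
theorem homFloor_625_of_entryTrees6RBKP_HT5QDCRX (P : ((Fin 3 × Fin 3) ⊕ Fin 3 → ℤ) → ((Fin 3 × Fin 3) ⊕ Fin 3 → ℤ) → HTCert)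
    (Qf : ((Fin 3 × Fin 3) ⊕ Fin 3 → ℤ) → ((Fin 3 × Fin 3) ⊕ Fin 3 → ℤ) → (Fin 4 → ℤ))
    (T : ((Fin 3 × Fin 3) ⊕ Fin 3 → ℤ) → ((Fin 3 × Fin 3) ⊕ Fin 3 → ℤ) → CertTree ((Fin 3 × Fin 3) ⊕ Fin 3))
    (hF : ∃ t : CertTree (Fin 3 × Fin 3), treeOK (entryLeafOK6RBKP muRec) t rootC rootW = true)
    (hH : ∃ t : CertTree ((Fin 3 × Fin 3) ⊕ Fin 3), treeOK (entryLeafOKHT5QDCRX muRec P Qf T) t rootCH rootWH = true) : HomFloor (1 / 625) := by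
  obtain ⟨tF, htF⟩ := hF
  obtain ⟨tH, htH⟩ := hH
  exact homFloor_of_prunedBoxSums_selfAdjoint (fccHalf_of_entryTree6RBKP muRec_ok htF) (hcpHalf_of_entryTreeHT5QDCRX muRec_ok P Qf T htH)

end Summit.AtomisticToContinuum.Crystallization.Theorems.FrustratedLawDichotomyStrainedPatchHomEntryLeafHT

end
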